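import Summits.NavierStokesRegularity.FunctionalMining.TopEigStrainMixDeriv
import Literature.Analysis.FunctionSpaces.TorusEnstrophyTrilinear
import HarnessLib

/-!
# FunctionalMining — the Euler production of `Φ₂ = ∫(λ₁⁺)²` through the enstrophy chain
# (static bound on `T³`, the row `q = 2`)

Search for candidate a priori estimates; no regularity claim. Cell `pub-nsfunc`, prove seat
(gen 24). The `q = 2` companion of `TopEigMixProduction` (which serves real `q > 2` through the
strain-moment chain): at `q = 2` the transport-free, selection-free Euler production of the `λ₁`
moment, `𝒩₊ = ∫ 2 λ₁ μ(S; −Π(p) − N(u))` (`TopEigProductionSplit`), is bounded through the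
ENSTROPHY chain of the tree — Cauchy–Schwarz, the pressure-Hessian Calderón–Zygmund inequality at
exponent `2`, and Ladyzhenskaya's `∫|∇u|⁴ ≤ K ‖∇u‖₂ ‖Δu‖₂³`
(`Torus.integral_sum_norm_sq_partialDeriv_sq_le`, Foias–Manley–Rosa–Temam (A.27)):

* **`TopEig.eulerProduction_two_le`** — along an unforced classical solution on `T³`, at every
  time of the window, `∫ 2 λ₁ μ(S; −Π(p) − N(u)) ≤ 2 (2(81 C_P + 1) K)^{1/2} E^{3/4} L^{3/4}` with
  `E = ‖∇u‖₂² = 2ℰ` (`Torus.gradNormSq`) and `L = ‖Δu‖₂²` — the same shape `E^{3/4} L^{3/4}` as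
  the tree's bound of the enstrophy production `|∫⟪(u·∇)u, Δu⟫|`
  (`Torus.abs_integral_inner_convect_laplacian_le`).

Used by `TopEigStrainMixLawTwo` (K1-Q6 (a) at `q = 2`: `Φ₂ + ε ℰ` obeys `T_LD` with `σ = 1`,
`γ = 3` for every `ε > 0`). Constants existential. [ours]
-/

noncomputable section

open MeasureTheory Set Filter Topology Finset

namespace Summit.NavierStokesRegularity.FunctionalMining

open Literature.Analysis.FunctionSpaces Literature.Analysis.FluidPDE

namespace TopEig

open StrainL4 StrainMoment VorticityL4 StrainTensor Torus

/-- **The Euler production of `Φ₂` through the enstrophy chain.** Along an unforced classical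
solution on `T³`, with a Ladyzhenskaya constant `K` (`∫(∑ₘ‖∂ₘw‖²)² ≤ K (‖∇w‖₂²)^{1/2}(‖Δw‖₂²)^{3/2}`)
and a pressure-Hessian Calderón–Zygmund constant `C_P` at exponent `2` along the solution:
`∫ 2 λ₁ μ(S; −Π(p) − N(u)) ≤ 2 (2(81 C_P + 1) K)^{1/2} (‖∇u‖₂²)^{3/4} (‖Δu‖₂²)^{3/4}`. [ours] -/
theorem eulerProduction_two_le {K CP : ℝ} (hK0 : 0 ≤ K) (hCP0 : 0 ≤ CP)
    (hK : ∀ w : UnitAddTorus (Fin 3) → EuclideanSpace ℝ (Fin 3), IsSmooth w →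
      ∫ x, (∑ m, ‖partialDeriv m w x‖ ^ 2) ^ 2 ≤
        K * gradNormSq w ^ (1 / 2 : ℝ) * (∫ x, ‖Torus.laplacian w x‖ ^ 2) ^ (3 / 2 : ℝ))
    {a b ν : ℝ}
    {u : ℝ → UnitAddTorus (Fin 3) → EuclideanSpace ℝ (Fin 3)} {p : ℝ → UnitAddTorus (Fin 3) → ℝ}
    (hsol : IsClassicalNSSolutionOn (Icc a b) ν 0 u p)
    (hCP : ∀ t ∈ Icc a b, ∀ i j : Fin 3,
      ∫ x, |partialDeriv i (partialDeriv j (p t)) x| ^ (2 : ℝ) ≤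
        CP * ∫ x, (∑ k, ‖partialDeriv k (u t) x‖ ^ 2) ^ (2 : ℝ))
    {t : ℝ} (ht : t ∈ Icc a b) :
    ∫ x, 2 * torusStrainTopEig (u t) x ^ ((2 : ℝ) - 1) *
        dirTopEig (strainFlat (u t) x) (-pressVec (p t) x - nonlinVec (u t) x) ≤
      2 * (2 * (81 * CP + 1) * K) ^ (1 / 2 : ℝ) * gradNormSq (u t) ^ (3 / 4 : ℝ) *
        (∫ x, ‖Torus.laplacian (u t) x‖ ^ 2) ^ (3 / 4 : ℝ) := by
  have hv : IsSmooth (u t) := hsol.smooth_velocity.isSmooth_slice ht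
  have hdiv : IsDivFree (u t) := hsol.divFree t ht
  have hpt : IsSmooth (p t) := hsol.smooth_pressure.isSmooth_slice ht
  have h12 : (1 : ℝ) ≤ 2 := by norm_num
  have hφc : Continuous (strainFlat (u t)) := continuous_strainFlat hv
  have hhc := continuous_hessAbs hpt
  have hgc := VorticityL4.continuous_gradSq hv
  have hh0 : ∀ x, 0 ≤ ∑ i, ∑ j, |partialDeriv i (partialDeriv j (p t)) x| := fun x =>
    Finset.sum_nonneg fun i _ => Finset.sum_nonneg fun j _ => abs_nonneg _
  have hg0 : ∀ x, 0 ≤ ∑ k, ‖partialDeriv k (u t) x‖ ^ 2 := fun x =>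
    Finset.sum_nonneg fun k _ => sq_nonneg _
  -- the quantities
  obtain ⟨E, hE⟩ : ∃ E : ℝ, E = gradNormSq (u t) := ⟨_, rfl⟩
  obtain ⟨L, hL⟩ : ∃ L : ℝ, L = ∫ x, ‖Torus.laplacian (u t) x‖ ^ 2 := ⟨_, rfl⟩
  obtain ⟨G₂, hG₂⟩ : ∃ G : ℝ, G = ∫ x, (∑ k, ‖partialDeriv k (u t) x‖ ^ 2) ^ 2 := ⟨_, rfl⟩
  obtain ⟨H₂, hH₂⟩ : ∃ H : ℝ, H = ∫ x, (∑ i, ∑ j, |partialDeriv i (partialDeriv j (p t)) x|) ^ (2 : ℝ) :=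
    ⟨_, rfl⟩
  have hE0 : 0 ≤ E := by rw [hE]; exact gradNormSq_nonneg _
  have hL0 : 0 ≤ L := by rw [hL]; exact integral_nonneg fun x => sq_nonneg _
  have hG₂0 : 0 ≤ G₂ := by rw [hG₂]; exact integral_nonneg fun x => sq_nonneg _
  -- `∫ |S|² = ℰ = E/2`
  have hS2 : ∫ x, ‖strainFlat (u t) x‖ ^ (2 : ℝ) = 2⁻¹ * E := by
    rw [hE, ← torusEnstrophy_eq_integral_norm_sq hv hdiv]; rfl
  -- Ladyzhenskaya and the pressure Calderón–Zygmund bound at exponent 2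
  have hG₂le : G₂ ≤ K * E ^ (1 / 2 : ℝ) * L ^ (3 / 2 : ℝ) := by rw [hG₂, hE, hL]; exact hK (u t) hv
  have hH₂le : H₂ ≤ 81 * CP * G₂ := by
    have hH := integral_sum_abs_rpow_le (d := Fin 3)
      (H := fun i j x => partialDeriv i (partialDeriv j (p t)) x)
      (fun i j => ((hpt.partialDeriv j).partialDeriv i).continuous) h12
    simp only [Fintype.card_fin, Nat.cast_ofNat] at hH
    have hsum : ∑ i : Fin 3, ∑ j : Fin 3, ∫ x, |partialDeriv i (partialDeriv j (p t)) x| ^ (2 : ℝ) ≤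
        ∑ i : Fin 3, ∑ j : Fin 3, CP * G₂ := by
      refine Finset.sum_le_sum fun i _ => Finset.sum_le_sum fun j _ => ?_
      have h := hCP t ht i j
      have e : ∫ x, (∑ k, ‖partialDeriv k (u t) x‖ ^ 2) ^ (2 : ℝ) = G₂ := by
        rw [hG₂]; exact integral_congr_ae (ae_of_all _ fun x => Real.rpow_two _)
      rwa [e] at h
    have hsum' : ∑ i : Fin 3, ∑ j : Fin 3, CP * G₂ = 9 * (CP * G₂) := by
      simp only [Finset.sum_const, Finset.card_univ, Fintype.card_fin]
      ring
    have h9 : ((3 : ℝ) ^ 2) ^ ((2 : ℝ) - 1) = 9 := by norm_num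
    calc H₂ ≤ ((3 : ℝ) ^ 2) ^ ((2 : ℝ) - 1) *
          ∑ i : Fin 3, ∑ j : Fin 3, ∫ x, |partialDeriv i (partialDeriv j (p t)) x| ^ (2 : ℝ) := by
          rw [hH₂]; exact hH
      _ ≤ 9 * (9 * (CP * G₂)) := by rw [h9, ← hsum']; exact mul_le_mul_of_nonneg_left hsum (by norm_num)
      _ = 81 * CP * G₂ := by ring
  -- the density `B = h + g` and `∫ B² ≤ 2(81 C_P + 1) G₂`
  have hB2 : ∫ x, (∑ i, ∑ j, |partialDeriv i (partialDeriv j (p t)) x| +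
      ∑ k, ‖partialDeriv k (u t) x‖ ^ 2) ^ (2 : ℝ) ≤ 2 * (81 * CP + 1) * G₂ := by
    have hpt' : ∀ x, (∑ i, ∑ j, |partialDeriv i (partialDeriv j (p t)) x| +
        ∑ k, ‖partialDeriv k (u t) x‖ ^ 2) ^ (2 : ℝ) ≤
        2 * (∑ i, ∑ j, |partialDeriv i (partialDeriv j (p t)) x|) ^ (2 : ℝ) +
          2 * (∑ k, ‖partialDeriv k (u t) x‖ ^ 2) ^ 2 := by
      intro x
      rw [Real.rpow_two, Real.rpow_two]
      nlinarith [sq_nonneg (∑ i, ∑ j, |partialDeriv i (partialDeriv j (p t)) x| -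
        ∑ k, ‖partialDeriv k (u t) x‖ ^ 2)]
    have hi1 : Integrable (fun x => 2 * (∑ i, ∑ j, |partialDeriv i (partialDeriv j (p t)) x|) ^ (2 : ℝ))
        volume := (continuous_const.mul (hhc.rpow_const fun _ => Or.inr (by norm_num))).integrable_unitAddTorus
    have hi2 : Integrable (fun x => 2 * (∑ k, ‖partialDeriv k (u t) x‖ ^ 2) ^ 2) volume :=
      (continuous_const.mul (hgc.pow 2)).integrable_unitAddTorus
    calc _ ≤ ∫ x, (2 * (∑ i, ∑ j, |partialDeriv i (partialDeriv j (p t)) x|) ^ (2 : ℝ) +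
          2 * (∑ k, ‖partialDeriv k (u t) x‖ ^ 2) ^ 2) :=
        integral_mono_of_nonneg (ae_of_all _ fun x => Real.rpow_nonneg (add_nonneg (hh0 x) (hg0 x)) _)
          (hi1.add hi2) (ae_of_all _ hpt')
      _ = 2 * H₂ + 2 * G₂ := by rw [integral_add hi1 hi2, integral_const_mul, integral_const_mul, hH₂, hG₂]
      _ ≤ 2 * (81 * CP * G₂) + 2 * G₂ := by linarith
      _ = 2 * (81 * CP + 1) * G₂ := by ring
  -- the pointwise bound, integrated, and Cauchy–Schwarz
  have hint_L : Integrable (fun x => 2 * torusStrainTopEig (u t) x ^ ((2 : ℝ) - 1) *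
      dirTopEig (strainFlat (u t) x) (-pressVec (p t) x - nonlinVec (u t) x)) volume :=
    integrable_topEigDensity h12 hv hdiv
      ((isSmooth_pressVec hpt).continuous.neg.sub (isSmooth_nonlinVec hv).continuous)
  have hφr : Continuous fun x => ‖strainFlat (u t) x‖ ^ ((2 : ℝ) - 1) :=
    VelocityMoment.continuous_norm_rpow' hφc (by norm_num)
  have hRc : Continuous fun x => 2 * (‖strainFlat (u t) x‖ ^ ((2 : ℝ) - 1) *
      (∑ i, ∑ j, |partialDeriv i (partialDeriv j (p t)) x| + ∑ k, ‖partialDeriv k (u t) x‖ ^ 2)) :=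
    continuous_const.mul (hφr.mul (hhc.add hgc))
  have hle : ∫ x, 2 * torusStrainTopEig (u t) x ^ ((2 : ℝ) - 1) *
      dirTopEig (strainFlat (u t) x) (-pressVec (p t) x - nonlinVec (u t) x) ≤
      2 * ∫ x, ‖strainFlat (u t) x‖ ^ ((2 : ℝ) - 1) *
        (∑ i, ∑ j, |partialDeriv i (partialDeriv j (p t)) x| + ∑ k, ‖partialDeriv k (u t) x‖ ^ 2) := by
    rw [← integral_const_mul]
    exact integral_mono hint_L hRc.integrable_unitAddTorus fun x => topEigDensity_hessian_le h12 hv hdiv (p t) x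
  have hCS := integral_rpow_mul_le_holder hφc.norm (hhc.add hgc) (fun x => norm_nonneg _)
    (fun x => add_nonneg (hh0 x) (hg0 x)) (by norm_num : (1 : ℝ) < 2)
  rw [hS2] at hCS
  -- numerics of the exponents
  have e12 : ((2 : ℝ) - 1) / 2 = 1 / 2 := by norm_num
  rw [e12] at hCS
  have hE2 : (2⁻¹ * E) ^ (1 / 2 : ℝ) ≤ E ^ (1 / 2 : ℝ) :=
    Real.rpow_le_rpow (by positivity) (by linarith) (by norm_num)
  have hBsq : (∫ x, (∑ i, ∑ j, |partialDeriv i (partialDeriv j (p t)) x| +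
      ∑ k, ‖partialDeriv k (u t) x‖ ^ 2) ^ (2 : ℝ)) ^ (1 / 2 : ℝ) ≤
      (2 * (81 * CP + 1) * K * E ^ (1 / 2 : ℝ) * L ^ (3 / 2 : ℝ)) ^ (1 / 2 : ℝ) := by
    refine Real.rpow_le_rpow (integral_nonneg fun x => Real.rpow_nonneg (add_nonneg (hh0 x) (hg0 x)) _)
      (hB2.trans ?_) (by norm_num)
    have h281 : 0 ≤ 2 * (81 * CP + 1) := by positivity
    calc 2 * (81 * CP + 1) * G₂ ≤ 2 * (81 * CP + 1) * (K * E ^ (1 / 2 : ℝ) * L ^ (3 / 2 : ℝ)) :=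
          mul_le_mul_of_nonneg_left hG₂le h281
      _ = _ := by ring
  have hsplit : (2 * (81 * CP + 1) * K * E ^ (1 / 2 : ℝ) * L ^ (3 / 2 : ℝ)) ^ (1 / 2 : ℝ) =
      (2 * (81 * CP + 1) * K) ^ (1 / 2 : ℝ) * E ^ (1 / 4 : ℝ) * L ^ (3 / 4 : ℝ) := by
    have h1 : 0 ≤ 2 * (81 * CP + 1) * K := by positivity
    rw [Real.mul_rpow (by positivity) (Real.rpow_nonneg hL0 _),
      Real.mul_rpow h1 (Real.rpow_nonneg hE0 _), ← Real.rpow_mul hE0, ← Real.rpow_mul hL0]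
    norm_num
  rw [hsplit] at hBsq
  have hC0 : 0 ≤ (2 * (81 * CP + 1) * K) ^ (1 / 2 : ℝ) := Real.rpow_nonneg (by positivity) _
  have hprod : (2⁻¹ * E) ^ (1 / 2 : ℝ) *
      (∫ x, (∑ i, ∑ j, |partialDeriv i (partialDeriv j (p t)) x| +
        ∑ k, ‖partialDeriv k (u t) x‖ ^ 2) ^ (2 : ℝ)) ^ (1 / 2 : ℝ) ≤
      E ^ (1 / 2 : ℝ) * ((2 * (81 * CP + 1) * K) ^ (1 / 2 : ℝ) * E ^ (1 / 4 : ℝ) * L ^ (3 / 4 : ℝ)) :=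
    mul_le_mul hE2 hBsq (Real.rpow_nonneg (integral_nonneg fun x =>
      Real.rpow_nonneg (add_nonneg (hh0 x) (hg0 x)) _) _) (Real.rpow_nonneg hE0 _)
  have hE34 : E ^ (1 / 2 : ℝ) * E ^ (1 / 4 : ℝ) = E ^ (3 / 4 : ℝ) := by
    rw [← Real.rpow_add' hE0 (by norm_num)]; norm_num
  calc _ ≤ 2 * ∫ x, ‖strainFlat (u t) x‖ ^ ((2 : ℝ) - 1) *
        (∑ i, ∑ j, |partialDeriv i (partialDeriv j (p t)) x| + ∑ k, ‖partialDeriv k (u t) x‖ ^ 2) := hle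
    _ ≤ 2 * (E ^ (1 / 2 : ℝ) * ((2 * (81 * CP + 1) * K) ^ (1 / 2 : ℝ) * E ^ (1 / 4 : ℝ) * L ^ (3 / 4 : ℝ))) :=
        mul_le_mul_of_nonneg_left (hCS.trans hprod) (by norm_num)
    _ = 2 * (2 * (81 * CP + 1) * K) ^ (1 / 2 : ℝ) * (E ^ (1 / 2 : ℝ) * E ^ (1 / 4 : ℝ)) * L ^ (3 / 4 : ℝ) := by
        ring
    _ = _ := by rw [hE34, hE, hL]

end TopEig

end Summit.NavierStokesRegularity.FunctionalMining

end
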